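import Summits.BirchSwinnertonDyer.BirchSwinnertonDyer.Theorems.UniversalToricDescentLocalTermClosedForm
import Summits.BirchSwinnertonDyer.BirchSwinnertonDyer.Theorems.UniversalToricDescentSigmaLocalFinite
import HarnessLib

/-!
# Route UniversalToricDescent — the localised algebraic half of 21845 with the local exponents in CLOSED
# FORM: `λ_alg(E) + Σ_{v∈Σ} 3^{c_v} s_v(E) = n′ + Σ_{v∈Σ} 3^{c_v} s_v(E′)`, `s_v(·) = d_v(·)` read off the
# reduction type of the curve at `v`

Lead prover bsd-wall-utd-p1 g10 (`--supports stmt-BirchSwinnertonDyer-20399`; memo GV24-ADDITIVE-LOCAL-TERM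
§2). `UniversalToricDescentSigmaLocalImage.invariantsTransportT_algebraicHalf_lambda` (g8) produces the bad
set `Σ`, the indices `c_v` and local exponents `s_v(E)`, `s_v(E′)` DEFINED by
`#H¹(kerD κ v, ·[3^∞])[3] = 3^{s_v}`. With the closed form of Greenberg–Vatsal's Prop. (2.4) at every
place `v ∤ 3` (`UniversalToricDescentLocalTermClosedForm`, g9 + g10) these exponents are explicit:

* `localExponent_eq_ite` — `#H¹(kerD κ v, E[p^∞])[p] = p^s` forces
  `s = (good ? (p ∣ q_v+1−a_v ? (p ∣ q_v−1 ? 2 : 1) : 0) : split mult ? [p ∣ 1−q_v] : mult ? [p ∣ −1−q_v] : 0)`;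
* `invariantsTransportT_algebraicHalf_lambda_closedForm` — the g8 statement with, for every `v ∈ Σ`, the
  two extra conjuncts `s_v(E) = d_v(E_K)` and `s_v(E′) = d_v(E′_K)` in this closed form. So the algebraic
  half of T reads `λ_alg(E) = n′ + Σ_{v∈Σ} 3^{c_v} (d_v(E′_K) − d_v(E_K))` with every term on the right an
  explicit function of the local data `(reduction type, a_v, q_v) mod 3` — the prediction the analytic half
  (Euler factors of the Σ-depleted `3`-adic `L`-functions, Greenberg–Vatsal (1.4)/(2.10)) has to meet.

HONEST STATUS: CONDITIONAL on the same binders as g8's theorem (21845's shape + (iv) + base finiteness ×2 +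
Poitou–Tate ×2); analytic half and 20395 unchanged. THEOREMS ONLY; no definition, no named fact, no
`sorry`. BSD is not advanced by this file.
References: [GreenbergVatsal2000] Thm. (1.4), §2 Prop. (2.4), (2.10); [GreenbergLNM1716] §3 Lemma 3.3.
-/

set_option autoImplicit false
-- `…BirchSwinnertonDyer.BirchSwinnertonDyer.Theorems…` is the problem's mandated namespace (D-0017).
set_option linter.dupNamespace false

noncomputable section

open scoped Classical

namespace Summit.BirchSwinnertonDyer.BirchSwinnertonDyer.Theorems.UniversalToricDescentSigmaLocalImage

open Function Field NumberField IsDedekindDomain WeierstrassCurve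
open Literature.NumberTheory.GaloisRepresentations Literature.NumberTheory.EllipticCurves
  Literature.NumberTheory.EllipticCurves.GreenbergSelmer Literature.NumberTheory.GaloisCohomology
  Literature.NumberTheory.EllipticCurves.IwasawaAlgebra Literature.NumberTheory.EllipticCurves.Rank1Residual
  Summit.BirchSwinnertonDyer.Rank1Residual Summit.BirchSwinnertonDyer.Rank1Residual.X11b
  Summit.BirchSwinnertonDyer.Rank1Residual.X11b.Coinv Summit.BirchSwinnertonDyer.Rank1Residual.X11b.AcSelmer
  Summit.BirchSwinnertonDyer.Rank1Residual.Iwasawa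
  Summit.BirchSwinnertonDyer.BirchSwinnertonDyer.Theorems.UniversalToricDescentLocalTermClosedForm

/-! ### §1 The local exponent is determined -/

section Local

variable {K : Type} [Field K] [NumberField K] (W : WeierstrassCurve K) [W.IsElliptic] {p : ℕ}
  [hp : Fact p.Prime] (κ : ZpExtension K p) {v : HeightOneSpectrum (𝓞 K)}

/-- **The local exponent in closed form.** If `#H¹(kerD κ v, E[p^∞])[p] = p^s` at a place `v ∤ p` with
`D_v ⊄ ker κ`, then `s` is Greenberg–Vatsal's `d_v`: at a good place `0 / 1 / 2` according to
`p ∤ q_v + 1 − a_v` / else / `p ∣ q_v − 1` too; at a split multiplicative place `[p ∣ 1 − q_v]`; at a non-split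
one `[p ∣ −1 − q_v]`; at an additive place `0`. [cite: GreenbergVatsal2000, §2 Prop. (2.4) and proof (arXiv p. 22)] -/
theorem localExponent_eq_ite (hpv : (p : 𝓞 K) ∉ v.asIdeal) (hD : ¬ (decomp v ≤ κ.kerSubgroup)) {s : ℕ}
    (hs : Nat.card {f : subgroupH1 (kerD κ v) (W.geomPrimaryTorsion p) // p • f = 0} = p ^ s) :
    s = (if W.HasGoodReductionAt v then
              (if (p : ℤ) ∣ (Nat.card (IsLocalRing.ResidueField (v.adicCompletionIntegers K)) : ℤ) + 1 -
                    W.frobeniusTraceAt v then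
                (if (p : ℤ) ∣ (Nat.card (IsLocalRing.ResidueField (v.adicCompletionIntegers K)) : ℤ) - 1
                  then 2 else 1)
                else 0)
            else if W.HasSplitMultiplicativeReductionAt v then
              (if (p : ℤ) ∣ 1 - (Nat.card (IsLocalRing.ResidueField (v.adicCompletionIntegers K)) : ℤ)
                then 1 else 0)
            else if W.HasMultiplicativeReductionAt v then
              (if (p : ℤ) ∣ -1 - (Nat.card (IsLocalRing.ResidueField (v.adicCompletionIntegers K)) : ℤ)
                then 1 else 0)
            else 0) := by
  have h := natCard_pTorsion_subgroupH1_kerD_eq_pow_ite W κ hpv hD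
  rw [hs] at h
  exact Nat.pow_right_injective hp.out.two_le h

end Local

/-! ### §2 The localised algebraic half with explicit exponents -/

open Summit.BirchSwinnertonDyer.Rank1Residual.X11b.LocBridge in
/-- **`λ_alg(E) + Σ_{v∈Σ} 3^{c_v}·s_v(E) = n′ + Σ_{v∈Σ} 3^{c_v}·s_v(E′)` with `s_v(E) = d_v(E_K)` and
`s_v(E′) = d_v(E′_K)` in closed form.** Same binders as `invariantsTransportT_algebraicHalf_lambda`; for
every `v ∈ Σ` the exponents are Greenberg–Vatsal's `d_v` of the respective curve over `K` at `v` (good: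
by `(a_v, q_v) mod 3`; split / non-split multiplicative: `[3 ∣ ±1 − q_v]`; additive: `0`).
[cite: GreenbergVatsal2000, Thm. (1.4), §2 Prop. (2.4) and (2.10) (pp. 22–28)] [cite: GreenbergLNM1716, §3 Lemma 3.3] -/
theorem invariantsTransportT_algebraicHalf_lambda_closedForm (W W' : WeierstrassCurve ℚ) [W.IsElliptic]
    [W.IsGloballyMinimal] [W'.IsElliptic] [W'.IsGloballyMinimal] {N N' : ℕ} (K : Type) [Field K]
    [NumberField K]
    (hO6 : Additive.ClassO6 W 3) (hN : W.conductorNorm ℤ = N) (hcong : O6.ModPCongruent W' W 3)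
    (hN' : W'.conductorNorm ℤ = N') (hK : IsImaginaryQuadratic K)
    (hHe : SatisfiesHeegnerHypothesis N K) (hHe' : SatisfiesHeegnerHypothesis N' K)
    (κ : ZpExtension K 3) (hκ : κ.IsAnticyclotomic) (γ : absoluteGaloisGroup K)
    [Fact (κ.IsTopGenerator γ)] {𝔭' : HeightOneSpectrum (𝓞 K)} (h𝔭' : ((3 : ℕ) : 𝓞 K) ∈ 𝔭'.asIdeal)
    (hT' : Module.IsTorsion (IwasawaAlgebra 3) (XAc (W'.baseChange K) 3 κ 𝔭' ∅ γ))
    {L' : UnrSeries 3} {n' : ℕ}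
    (hL' : (XAc.charIdeal (W'.baseChange K) 3 κ 𝔭' ∅ γ).map (PowerSeries.map (Halves.toUnr 3)) =
      Ideal.span {L'})
    (hn' : (∀ i < n', ‖((PowerSeries.coeff i L' : unrIntegers 3) : ℂ_[3])‖ < 1) ∧
      ‖((PowerSeries.coeff n' L' : unrIntegers 3) : ℂ_[3])‖ = 1)
    (h4 : ∀ R : (W.baseChange ℚ_[3]).toAffine.Point, 3 • R = 0 → R = 0)
    (hPT : poitouTate_selmerStructure_duality K) (hPT2 : poitouTate_sha_tateDual K)
    (hfin : ∀ v : HeightOneSpectrum (𝓞 K), ((3 : ℕ) : 𝓞 K) ∈ v.asIdeal →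
      Finite (selmerAcBase (W.baseChange K) 3 v ∅))
    (hfin' : ∀ v : HeightOneSpectrum (𝓞 K), ((3 : ℕ) : 𝓞 K) ∈ v.asIdeal →
      Finite (selmerAcBase (W'.baseChange K) 3 v ∅)) :
    ∃ (T : Finset (HeightOneSpectrum (𝓞 K))) (c s s' : HeightOneSpectrum (𝓞 K) → ℕ),
      (↑T = {v : HeightOneSpectrum (𝓞 K) | ((3 : ℕ) : 𝓞 K) ∉ v.asIdeal ∧
        (¬ (W.baseChange K).HasGoodReductionAt v ∨ ¬ (W'.baseChange K).HasGoodReductionAt v)}) ∧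
      (∀ v ∈ T, (∃ d₀ : decomp (K := K) v, (κ (d₀ : absoluteGaloisGroup K)).toAdd = (3 : ℤ_[3]) ^ c v) ∧
        (∀ d : decomp (K := K) v, (3 : ℤ_[3]) ^ c v ∣ (κ (d : absoluteGaloisGroup K)).toAdd) ∧
        Nat.card {f : subgroupH1 (kerD κ v) ((W.baseChange K).geomPrimaryTorsion 3) // 3 • f = 0} =
          3 ^ s v ∧
        Nat.card {f : subgroupH1 (kerD κ v) ((W'.baseChange K).geomPrimaryTorsion 3) // 3 • f = 0} =
          3 ^ s' v ∧
        s v = (if (W.baseChange K).HasGoodReductionAt v then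
              (if ((3 : ℕ) : ℤ) ∣ (Nat.card (IsLocalRing.ResidueField (v.adicCompletionIntegers K)) : ℤ) + 1 -
                    (W.baseChange K).frobeniusTraceAt v then
                (if ((3 : ℕ) : ℤ) ∣ (Nat.card (IsLocalRing.ResidueField (v.adicCompletionIntegers K)) : ℤ) - 1
                  then 2 else 1)
                else 0)
            else if (W.baseChange K).HasSplitMultiplicativeReductionAt v then
              (if ((3 : ℕ) : ℤ) ∣ 1 - (Nat.card (IsLocalRing.ResidueField (v.adicCompletionIntegers K)) : ℤ)
                then 1 else 0)
            else if (W.baseChange K).HasMultiplicativeReductionAt v then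
              (if ((3 : ℕ) : ℤ) ∣ -1 - (Nat.card (IsLocalRing.ResidueField (v.adicCompletionIntegers K)) : ℤ)
                then 1 else 0)
            else 0) ∧
        s' v = (if (W'.baseChange K).HasGoodReductionAt v then
              (if ((3 : ℕ) : ℤ) ∣ (Nat.card (IsLocalRing.ResidueField (v.adicCompletionIntegers K)) : ℤ) + 1 -
                    (W'.baseChange K).frobeniusTraceAt v then
                (if ((3 : ℕ) : ℤ) ∣ (Nat.card (IsLocalRing.ResidueField (v.adicCompletionIntegers K)) : ℤ) - 1
                  then 2 else 1)
                else 0)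
            else if (W'.baseChange K).HasSplitMultiplicativeReductionAt v then
              (if ((3 : ℕ) : ℤ) ∣ 1 - (Nat.card (IsLocalRing.ResidueField (v.adicCompletionIntegers K)) : ℤ)
                then 1 else 0)
            else if (W'.baseChange K).HasMultiplicativeReductionAt v then
              (if ((3 : ℕ) : ℤ) ∣ -1 - (Nat.card (IsLocalRing.ResidueField (v.adicCompletionIntegers K)) : ℤ)
                then 1 else 0)
            else 0)) ∧
      Module.IsTorsion (IwasawaAlgebra 3) (XAc (W.baseChange K) 3 κ 𝔭' ∅ γ) ∧
      (∃ g : UnrSeries 3,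
        (XAc.charIdeal (W.baseChange K) 3 κ 𝔭' ∅ γ).map (PowerSeries.map (Halves.toUnr 3)) =
            Ideal.span {g} ∧
          (∀ i < lambdaInvariant 3 (XAc (W.baseChange K) 3 κ 𝔭' ∅ γ),
            ‖((PowerSeries.coeff i g : unrIntegers 3) : ℂ_[3])‖ < 1) ∧
          ‖((PowerSeries.coeff (lambdaInvariant 3 (XAc (W.baseChange K) 3 κ 𝔭' ∅ γ)) g :
            unrIntegers 3) : ℂ_[3])‖ = 1) ∧
      lambdaInvariant 3 (XAc (W.baseChange K) 3 κ 𝔭' ∅ γ) + ∑ v ∈ T, 3 ^ c v * s v =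
        n' + ∑ v ∈ T, 3 ^ c v * s' v := by
  haveI : Fact (Nat.Prime 3) := ⟨Nat.prime_three⟩
  obtain ⟨T, c, s, s', hT, hcT, hTor, hg, hcount⟩ :=
    invariantsTransportT_algebraicHalf_lambda W W' K hO6 hN hcong hN' hK hHe hHe' κ hκ γ h𝔭' hT' hL' hn'
      h4 hPT hPT2 hfin hfin'
  refine ⟨T, c, s, s', hT, fun v hv ↦ ?_, hTor, hg, hcount⟩
  obtain ⟨hc1, hc2, hs, hs'⟩ := hcT v hv
  -- `v ∤ 3` and `D_v ⊄ ker κ`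
  have hTp : ((3 : ℕ) : 𝓞 K) ∉ v.asIdeal := by
    have h : v ∈ (↑T : Set (HeightOneSpectrum (𝓞 K))) := Finset.mem_coe.mpr hv
    rw [hT] at h
    exact h.1
  have hTdec : ¬ (decomp v ≤ κ.kerSubgroup) := by
    intro hle
    obtain ⟨d₀, hd₀⟩ := hc1
    have h1 : κ (d₀ : absoluteGaloisGroup K) = 1 := (ZpExtension.mem_kerSubgroup).mp (hle d₀.2)
    rw [h1, toAdd_one] at hd₀
    exact pow_ne_zero (c v) (by norm_num : (3 : ℤ_[3]) ≠ 0) hd₀.symm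
  exact ⟨hc1, hc2, hs, hs', localExponent_eq_ite (W.baseChange K) κ hTp hTdec hs,
    localExponent_eq_ite (W'.baseChange K) κ hTp hTdec hs'⟩

end Summit.BirchSwinnertonDyer.BirchSwinnertonDyer.Theorems.UniversalToricDescentSigmaLocalImage

end
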